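import Summits.QuantumFields.YangMills.Theorems.BalabanLadderUVSeamRecCeilingsProductMomentsCurrency
import HarnessLib

/-!
# Crux `UVSeamRec` (stmt-QuantumFields-20043), v5(α)/(α′): the SECOND-ORDER product currency (PM₂) — one multiplicative
# family that feeds BOTH the ceilings collar (first order) and the floors' mean-square response law (second order)

Helper file (`--supports stmt-QuantumFields-20043`) of the stub-helper seat `ym-20043-seam-s2` (lane S-A, gen 2); sequel of
`…CeilingsProductMoments.lean` (p542286) / `…CeilingsProductMomentsCurrency.lean` (p544257).

LOCATED CONTEXT (LEAD ym-spine-20043-p1 g8, fleet INBOX 2026-08-27T16:18:22Z, (2)): the product currency (PM) of p542286 is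
exactly what the COLLAR consumes, but at singletons it only gives the FIRST moment `⟨(R⁴/C₁)|kerE − p|⟩ ≤ e^B − 1`, whereas
the (S-B) floors glue of the v5(α′) candidate (seam-s1's `MarkovMirror.torusE_sq_le_of_expMoment` /
`typicalLaw_of_responseMoments`) extracts from the SINGLETON exponential moment of (RM) the SECOND moment
`E_T[(kerE − p)²] ≤ 2e^B C₁²/R⁸`.  So a v6 re-keyed to (PM) would not feed α′'s floors.  The repair costs nothing in
spirit: ask for the product moments ONE ORDER HIGHER,

  (PM₂)  `⟨∏_{i∈T} (1 + Yᵢ + Yᵢ²/2)⟩_{2L+1,β} ≤ exp(B·#T)`,  `Yᵢ := (R⁴/C₁)|kerE_{cube i}(plane_i) − p (q i) β|`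

(same guards).  Since `1 + y ≤ 1 + y + y²/2 ≤ eʸ` (`y ≥ 0`):  (RM) ⇒ (PM₂) ⇒ (PM) ⇒ `MomentBounds6`, and at singletons
(PM₂) gives the MEAN-SQUARE law `E_T[(kerE − p)²] ≤ 2(e^B − 1)·C₁²/R⁸` — the floors' input at the rate `R⁻⁸` it needs.
(PM₂) still asks only POLYNOMIAL (second) moments per cube and multiplicativity across cubes (for independent responses:
first and second moments only) — no exponential tail.

* §1 `productMoments_of_productMoments₂` — (PM₂) ⇒ (PM) (hence ⇒ `MomentBounds6` by p542286, and the press-button p544257).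
* §2 `productMoments₂_of_responseMoments` — (RM) ⇒ (PM₂) (`Real.quadratic_le_exp_of_nonneg`).
* §3 `torusE_sq_le_of_prodMoment₂` (one site: `⟨1 + λ|Φ − p| + λ²(Φ − p)²/2⟩ ≤ e^B`, `λ > 0` ⇒ `⟨(Φ − p)²⟩ ≤ 2(e^B − 1)/λ²`),
  **`torusE_sq_response_le_of_productMoments₂`** — under (PM₂), on the guards: `E_T[(kerE_{x−(R+1),2R+3}(plane q x) − p q β)²]
  ≤ 2(e^B − 1) C₁²/R⁸` — the singleton exponential-moment OUTPUT of the floors chain, recovered from (PM₂).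

OWNER OPTION (no registry ask from this seat): if a v6 ever re-keys the measure-side stub below (RM), (PM₂) — not (PM) — is
the currency that keeps both the ceilings press-button and the α′ floors glue fed.  HONEST FRAMING: consumption-side
bookkeeping for OPEN currencies of a CONDITIONAL chain; nothing of E0′; not a gap, not Clay.

References: `1 + y + y²/2 ≤ eʸ` (Mathlib `Real.quadratic_le_exp_of_nonneg`).
-/

set_option autoImplicit false

noncomputable section

open MeasureTheory Filter Topology Finset
open Literature.Probability.LatticeModels
open Literature.MathematicalPhysics.QuantumFieldTheory (GaugeConfig wilsonMeasure isProbabilityMeasure_wilsonMeasure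
  measurable_torusLift LatticeRep)
open Literature.MathematicalPhysics.QuantumLattice
open Summit.QuantumFields.YangMills.Cruxes.OSLegsFromFemtoAndGap.DlrCollarTransfer
open Summit.QuantumFields.YangMills.Cruxes.UVSeamRec.TemperedResponse (continuous_kerE_plane)
open Summit.QuantumFields.YangMills.Cruxes.UVSeamRec.ResponsePinning (torusE_mono torusE_const torusE_add'
  torusE_const_mul')

namespace Summit.QuantumFields.YangMills.Cruxes.UVSeamRec.ProductMoments

variable {G : Type} [Group G] [TopologicalSpace G] [IsTopologicalGroup G] [CompactSpace G]
  [MeasurableSpace G] [BorelSpace G] (r : LatticeRep G) (a : ℝ → ℝ)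

/-- Continuity of a second-order response product in the exterior. [folklore] -/
theorem continuous_prod_response₂ (β : ℝ) {n : ℕ} (T : Finset (Fin n)) (q : Fin n → Fin 4 × Fin 4)
    (x : Fin n → (Fin 4 → ℤ)) (R : ℕ) (lam : ℝ) (c : Fin n → ℝ) :
    Continuous fun U : LGConfig 4 G => ∏ i ∈ T, (1 + lam *
      |kerE G r β (fun k => x i k - (R + 1)) (2 * R + 3) U (plane G r (q i) (x i)) - c i| + (lam *
      |kerE G r β (fun k => x i k - (R + 1)) (2 * R + 3) U (plane G r (q i) (x i)) - c i|) ^ 2 / 2) := by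
  refine continuous_finsetProd T fun i _ => ?_
  have hc : Continuous fun U : LGConfig 4 G => lam *
      |kerE G r β (fun k => x i k - (R + 1)) (2 * R + 3) U (plane G r (q i) (x i)) - c i| :=
    continuous_const.mul ((continuous_kerE_plane r β _ _ (q i) (x i)).sub continuous_const).abs
  exact (continuous_const.add hc).add ((hc.pow 2).div_const _)

/-! ## §1 (PM₂) ⇒ (PM) -/

/-- **(PM₂) ⇒ (PM).**  The second-order product moments dominate the first-order ones (`1 + y ≤ 1 + y + y²/2`): on the
same guards and for every `T`, `⟨∏(1 + Yᵢ)⟩ ≤ ⟨∏(1 + Yᵢ + Yᵢ²/2)⟩ ≤ exp(B·#T)` — so (PM₂) feeds the collar through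
p542286 `momentBounds6_of_productMoments` and the press-button p544257 `stubCeilings_of_productMoments`. [folklore] -/
theorem productMoments_of_productMoments₂ {C₁ B β₁ ℓ₁ : ℝ} {p : Fin 4 × Fin 4 → ℝ → ℝ} (hC₁ : 0 < C₁)
    (hPM₂ : ∀ β : ℝ, β₁ ≤ β → ∀ (L n : ℕ) (q : Fin n → Fin 4 × Fin 4) (x : Fin n → (Fin 4 → ℤ)) (R : ℕ),
      (∀ i, (q i).1 < (q i).2) → 1 ≤ R → (R : ℝ) * a β ≤ ℓ₁ → 4 * R + 8 ≤ L →
      (∀ i j : Fin n, i ≠ j → ∃ k : Fin 4,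
        (2 * (R : ℤ) + 4) ≤ |((((x i k - x j k : ℤ) : ZMod (2 * L + 1))).valMinAbs : ℤ)|) →
      ∀ T : Finset (Fin n),
        torusE G r β L (fun U => ∏ i ∈ T, (1 + (R : ℝ) ^ 4 / C₁ *
          |kerE G r β (fun k => x i k - (R + 1)) (2 * R + 3) U (plane G r (q i) (x i)) - p (q i) β| + ((R : ℝ) ^ 4 / C₁ *
          |kerE G r β (fun k => x i k - (R + 1)) (2 * R + 3) U (plane G r (q i) (x i)) - p (q i) β|) ^ 2 / 2)) ≤
          Real.exp (B * T.card)) :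
    ∀ β : ℝ, β₁ ≤ β → ∀ (L n : ℕ) (q : Fin n → Fin 4 × Fin 4) (x : Fin n → (Fin 4 → ℤ)) (R : ℕ),
      (∀ i, (q i).1 < (q i).2) → 1 ≤ R → (R : ℝ) * a β ≤ ℓ₁ → 4 * R + 8 ≤ L →
      (∀ i j : Fin n, i ≠ j → ∃ k : Fin 4,
        (2 * (R : ℤ) + 4) ≤ |((((x i k - x j k : ℤ) : ZMod (2 * L + 1))).valMinAbs : ℤ)|) →
      ∀ T : Finset (Fin n),
        torusE G r β L (fun U => ∏ i ∈ T, (1 + (R : ℝ) ^ 4 / C₁ *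
          |kerE G r β (fun k => x i k - (R + 1)) (2 * R + 3) U (plane G r (q i) (x i)) - p (q i) β|)) ≤
          Real.exp (B * T.card) := by
  intro β hβ L n q x R hq hR hRa hRL hsep T
  refine le_trans ?_ (hPM₂ β hβ L n q x R hq hR hRa hRL hsep T)
  refine torusE_mono r β L (continuous_prod_response r β T q x R _ _) (continuous_prod_response₂ r β T q x R _ _)
    fun U => ?_
  refine Finset.prod_le_prod (fun i _ => by positivity) fun i _ => ?_
  have : 0 ≤ ((R : ℝ) ^ 4 / C₁ *
      |kerE G r β (fun k => x i k - (R + 1)) (2 * R + 3) U (plane G r (q i) (x i)) - p (q i) β|) ^ 2 / 2 := by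
    positivity
  linarith

/-! ## §2 (RM) ⇒ (PM₂) -/

/-- **(RM) ⇒ (PM₂).**  The registered binder's joint exponential moments dominate the second-order product moments
(`1 + y + y²/2 ≤ eʸ` for `y ≥ 0`): on the same guards and for every `T`. [folklore] -/
theorem productMoments₂_of_responseMoments {C₁ B β₁ ℓ₁ : ℝ} {p : Fin 4 × Fin 4 → ℝ → ℝ} (hC₁ : 0 < C₁)
    (hRM : ∀ β : ℝ, β₁ ≤ β → ∀ (L n : ℕ) (q : Fin n → Fin 4 × Fin 4) (x : Fin n → (Fin 4 → ℤ)) (R : ℕ),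
      (∀ i, (q i).1 < (q i).2) → 1 ≤ R → (R : ℝ) * a β ≤ ℓ₁ → 4 * R + 8 ≤ L →
      (∀ i j : Fin n, i ≠ j → ∃ k : Fin 4,
        (2 * (R : ℤ) + 4) ≤ |((((x i k - x j k : ℤ) : ZMod (2 * L + 1))).valMinAbs : ℤ)|) →
      ∀ T : Finset (Fin n),
        torusE G r β L (fun U => Real.exp (∑ i ∈ T, (R : ℝ) ^ 4 / C₁ *
          |kerE G r β (fun k => x i k - (R + 1)) (2 * R + 3) U (plane G r (q i) (x i)) - p (q i) β|)) ≤
          Real.exp (B * T.card)) :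
    ∀ β : ℝ, β₁ ≤ β → ∀ (L n : ℕ) (q : Fin n → Fin 4 × Fin 4) (x : Fin n → (Fin 4 → ℤ)) (R : ℕ),
      (∀ i, (q i).1 < (q i).2) → 1 ≤ R → (R : ℝ) * a β ≤ ℓ₁ → 4 * R + 8 ≤ L →
      (∀ i j : Fin n, i ≠ j → ∃ k : Fin 4,
        (2 * (R : ℤ) + 4) ≤ |((((x i k - x j k : ℤ) : ZMod (2 * L + 1))).valMinAbs : ℤ)|) →
      ∀ T : Finset (Fin n),
        torusE G r β L (fun U => ∏ i ∈ T, (1 + (R : ℝ) ^ 4 / C₁ *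
          |kerE G r β (fun k => x i k - (R + 1)) (2 * R + 3) U (plane G r (q i) (x i)) - p (q i) β| + ((R : ℝ) ^ 4 / C₁ *
          |kerE G r β (fun k => x i k - (R + 1)) (2 * R + 3) U (plane G r (q i) (x i)) - p (q i) β|) ^ 2 / 2)) ≤
          Real.exp (B * T.card) := by
  intro β hβ L n q x R hq hR hRa hRL hsep T
  refine le_trans ?_ (hRM β hβ L n q x R hq hR hRa hRL hsep T)
  have hc : ∀ i : Fin n, Continuous fun U : LGConfig 4 G => (R : ℝ) ^ 4 / C₁ *
      |kerE G r β (fun k => x i k - (R + 1)) (2 * R + 3) U (plane G r (q i) (x i)) - p (q i) β| := fun i =>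
    continuous_const.mul ((continuous_kerE_plane r β _ _ (q i) (x i)).sub continuous_const).abs
  refine torusE_mono r β L (continuous_prod_response₂ r β T q x R _ _)
    (Real.continuous_exp.comp (continuous_finsetSum T fun i _ => hc i)) fun U => ?_
  rw [Real.exp_sum]
  exact Finset.prod_le_prod (fun i _ => by positivity) fun i _ =>
    Real.quadratic_le_exp_of_nonneg (by positivity)

/-! ## §3 (PM₂) at singletons is the MEAN-SQUARE response law -/

/-- The one-site second-order product-moment bound: `⟨1 + λ|Φ − p| + (λ|Φ − p|)²/2⟩ ≤ e^B` with `λ > 0` gives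
`⟨(Φ − p)²⟩ ≤ 2(e^B − 1)/λ²`. [folklore] -/
theorem torusE_sq_le_of_prodMoment₂ (β : ℝ) (L : ℕ) {Φ : LGConfig 4 G → ℝ} (hΦ : Continuous Φ) {lam : ℝ}
    (hlam : 0 < lam) {p B : ℝ}
    (h : torusE G r β L (fun U => 1 + lam * |Φ U - p| + (lam * |Φ U - p|) ^ 2 / 2) ≤ Real.exp B) :
    torusE G r β L (fun U => (Φ U - p) ^ 2) ≤ 2 * (Real.exp B - 1) / lam ^ 2 := by
  have hc1 : Continuous fun U => lam * |Φ U - p| := continuous_const.mul (hΦ.sub continuous_const).abs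
  have hc2 : Continuous fun U => (lam * |Φ U - p|) ^ 2 / 2 := (hc1.pow 2).div_const _
  -- drop the (nonnegative) first-order term
  have hmono : torusE G r β L (fun U => 1 + (lam * |Φ U - p|) ^ 2 / 2) ≤ Real.exp B := by
    refine le_trans (torusE_mono r β L (A := fun U => 1 + (lam * |Φ U - p|) ^ 2 / 2)
      (B := fun U => 1 + lam * |Φ U - p| + (lam * |Φ U - p|) ^ 2 / 2)
      (continuous_const.add hc2) ((continuous_const.add hc1).add hc2) fun U => ?_) h
    have : 0 ≤ lam * |Φ U - p| := by positivity
    show 1 + (lam * |Φ U - p|) ^ 2 / 2 ≤ 1 + lam * |Φ U - p| + (lam * |Φ U - p|) ^ 2 / 2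
    linarith
  rw [show (fun U => 1 + (lam * |Φ U - p|) ^ 2 / 2) = (fun U => (fun _ => (1 : ℝ)) U + (lam * |Φ U - p|) ^ 2 / 2)
    from rfl, torusE_add' r β L continuous_const hc2, torusE_const] at hmono
  have hsq : (fun U : LGConfig 4 G => (lam * |Φ U - p|) ^ 2 / 2) = fun U => lam ^ 2 / 2 * (Φ U - p) ^ 2 := by
    funext U; rw [mul_pow, sq_abs]; ring
  rw [hsq, torusE_const_mul'] at hmono
  rw [le_div_iff₀ (by positivity)]
  nlinarith

/-- **(PM₂) gives the floors' mean-square response law.**  Under (PM₂) at unit `a` [`p`, `C₁ > 0`, `B`, `β₁`, `ℓ₁`], for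
`β ≥ β₁`, `1 ≤ R`, `R·a β ≤ ℓ₁`, `4R+8 ≤ L`, `q.1 < q.2` and every site `x`:
`E_T[(kerE_{x−(R+1),2R+3}(plane q x) − p q β)²] ≤ 2(e^B − 1)·C₁²/R⁸` — the same singleton output the α′ floors glue takes
from (RM) (seam-s1 `MarkovMirror.torusE_sq_le_of_expMoment`: `2e^B C₁²/R⁸`), here from second-order PRODUCT moments.
[folklore] -/
theorem torusE_sq_response_le_of_productMoments₂ {C₁ B β₁ ℓ₁ : ℝ} {p : Fin 4 × Fin 4 → ℝ → ℝ} (hC₁ : 0 < C₁)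
    (hPM₂ : ∀ β : ℝ, β₁ ≤ β → ∀ (L n : ℕ) (q : Fin n → Fin 4 × Fin 4) (x : Fin n → (Fin 4 → ℤ)) (R : ℕ),
      (∀ i, (q i).1 < (q i).2) → 1 ≤ R → (R : ℝ) * a β ≤ ℓ₁ → 4 * R + 8 ≤ L →
      (∀ i j : Fin n, i ≠ j → ∃ k : Fin 4,
        (2 * (R : ℤ) + 4) ≤ |((((x i k - x j k : ℤ) : ZMod (2 * L + 1))).valMinAbs : ℤ)|) →
      ∀ T : Finset (Fin n),
        torusE G r β L (fun U => ∏ i ∈ T, (1 + (R : ℝ) ^ 4 / C₁ *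
          |kerE G r β (fun k => x i k - (R + 1)) (2 * R + 3) U (plane G r (q i) (x i)) - p (q i) β| + ((R : ℝ) ^ 4 / C₁ *
          |kerE G r β (fun k => x i k - (R + 1)) (2 * R + 3) U (plane G r (q i) (x i)) - p (q i) β|) ^ 2 / 2)) ≤
          Real.exp (B * T.card))
    {β : ℝ} (hβ : β₁ ≤ β) {L R : ℕ} (q : Fin 4 × Fin 4) (x : Fin 4 → ℤ) (hq : q.1 < q.2) (hR : 1 ≤ R)
    (hRa : (R : ℝ) * a β ≤ ℓ₁) (hRL : 4 * R + 8 ≤ L) :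
    torusE G r β L (fun U => (kerE G r β (fun k => x k - (R + 1)) (2 * R + 3) U (plane G r q x) - p q β) ^ 2) ≤
      2 * (Real.exp B - 1) * C₁ ^ 2 / (R : ℝ) ^ 8 := by
  have h1 := hPM₂ β hβ L 1 (fun _ => q) (fun _ => x) R (fun _ => hq) hR hRa hRL
    (fun i j hij => absurd (Subsingleton.elim i j) hij) Finset.univ
  simp only [Finset.univ_unique, Finset.prod_singleton, Finset.card_singleton, Nat.cast_one, mul_one] at h1
  have hR0 : (0 : ℝ) < R := by exact_mod_cast (show 0 < R by omega)
  have hlam : 0 < (R : ℝ) ^ 4 / C₁ := by positivity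
  have h2 := torusE_sq_le_of_prodMoment₂ r β L (continuous_kerE_plane r β _ _ q x) hlam (p := p q β) (B := B) h1
  refine h2.trans (le_of_eq ?_)
  field_simp

end Summit.QuantumFields.YangMills.Cruxes.UVSeamRec.ProductMoments

end
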